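import Summits.Ventures.CertifiedManyBodySolver.Downfold.RectAxisSaddle
import HarnessLib

/-!
# The RECTANGULAR one-band band, IV: diagonal and zone-face Fermi points, velocity windows and the `t–t′` form defects
# (orthorhombic analogue of `OneBandLineFermiPoints` / `OneBandInPlaneFormDefect` §3)

Venture CertifiedManyBodySolver, cell `pub/hubbard-downfold` (stage S1, technique B; INFL-3to1-B), seat hubbard-downfold-mod-4 (g25); namespace
`Summit.Ventures.CertifiedManyBodySolver.Downfold.Emery`. Everything PROVED; no number lives here. WHAT THIS IS NOT: a statement about any material;
`U = 0` one-body kinematics.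

For an orthorhombic plane the diagonal `kx = ky` is not a mirror line, but it still carries a Fermi crossing (the «nodal» direction of the tetragonal
limit), and the two zone faces `kx = π` (through X) and `ky = π` (through Y) are inequivalent; the Y face is the X face of the transposed list `rbT H`.

* §1 momentum derivatives in polynomial form (`hasDerivAt_rbBandK_kx_UV`), the squared Fermi velocity `rbGradSq`; the diagonal profile `rbDiag`
  (`d/du = ∂_u ε + ∂_v ε`), its 1-D kd monotonicity certificate `rbDiagMonoCheck`;
* §2 brackets and existence of the diagonal and X-face Fermi points (`rbNode_cos_mem_Ioo`, `rbFace_cos_mem_Ioo`, IVT), velocity windows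
  (`rbNodeGradSqE`, `rbFaceGradSqE`, `window_of_check₁`), pointwise theorems given a Fermi bracket (`rbNode_of_lineChecks`, `rbFace_of_lineChecks`);
* §3 the `t–t′` FORM DEFECT of the diagonal/X-face pair (`rbForm_of_windows`: same eight kd claims as `ipForm_of_windows` with the rectangular velocities).

Sources: one-band form [AndersenEtAl1995, §6]; interval verification [Moore1966, Theorem 3.1, §4.4].
-/

noncomputable section

namespace Summit.Ventures.CertifiedManyBodySolver.Downfold.Emery

open Real Set Literature.Analysis.ValidatedNumerics

/-! ## §1 Velocities and the diagonal profile -/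

/-- **`∂ε/∂kx = −sin kx · ∂_u ε(cos kx, cos ky)`** (rectangular band). [folklore] -/
theorem hasDerivAt_rbBandK_kx_UV {H : List (ℕ × ℕ × ℚ)} (hH : shellsOK H = true) (kx ky : ℝ) :
    HasDerivAt (fun kx => rbBandK H kx ky) (-sin kx * rbBandU H (cos kx) (cos ky)) kx := by
  have hf : (fun kx => rbBandK H kx ky) = fun kx => rbBandUV H (cos kx) (cos ky) := by
    funext k; exact rbBandK_eq_UV hH k ky
  rw [hf]
  have h := (hasDerivAt_rbBandUV H (cos kx) (cos ky)).comp kx (hasDerivAt_cos kx)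
  exact h.congr_deriv (by ring)

/-- **`∂ε/∂ky = −sin ky · ∂_u ε_{Hᵀ}(cos ky, cos kx)`.** [folklore] -/
theorem hasDerivAt_rbBandK_ky_UV {H : List (ℕ × ℕ × ℚ)} (hH : shellsOK H = true) (kx ky : ℝ) :
    HasDerivAt (fun ky => rbBandK H kx ky) (-sin ky * rbBandU (rbT H) (cos ky) (cos kx)) ky := by
  have hf : (fun ky => rbBandK H kx ky) = fun ky => rbBandK (rbT H) ky kx := funext fun k => rbBandK_transpose H kx k
  rw [hf]; exact hasDerivAt_rbBandK_kx_UV (shellsOK_rbT hH) ky kx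

/-- **The squared Fermi velocity** `|∇ε|²` of the rectangular band (with the derivatives above). [folklore] -/
def rbGradSq (H : List (ℕ × ℕ × ℚ)) (kx ky : ℝ) : ℝ :=
  (-sin kx * rbBandU H (cos kx) (cos ky)) ^ 2 + (-sin ky * rbBandU (rbT H) (cos ky) (cos kx)) ^ 2


/-- `|∇ε|²` is transpose-symmetric: `rbGradSq (rbT H) ky kx = rbGradSq H kx ky` (so Y-face statements about `rbT H` are statements about `H`). [folklore] -/
theorem rbGradSq_transpose (H : List (ℕ × ℕ × ℚ)) (kx ky : ℝ) : rbGradSq (rbT H) ky kx = rbGradSq H kx ky := by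
  unfold rbGradSq; rw [rbT_rbT]; ring

/-- The band on the Y face: `ε_H(k, π) = ε_{Hᵀ}(π, k)`. [folklore] -/
theorem rbBandK_yface (H : List (ℕ × ℕ × ℚ)) (k : ℝ) : rbBandK H k π = rbBandK (rbT H) π k := rbBandK_transpose H k π

/-- The diagonal is transpose-invariant: `ε_{Hᵀ}(k, k) = ε_H(k, k)`. [folklore] -/
theorem rbBandK_diag_transpose (H : List (ℕ × ℕ × ℚ)) (k : ℝ) : rbBandK (rbT H) k k = rbBandK H k k := (rbBandK_transpose H k k).symm

/-- The band on the diagonal `kx = ky` as a function of `u = cos k`. [folklore] -/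
def rbDiag (H : List (ℕ × ℕ × ℚ)) (u : ℝ) : ℝ := rbBandUV H u u

/-- `ε(k, k) = rbDiag H (cos k)`. [folklore] -/
theorem rbBandK_diag {H : List (ℕ × ℕ × ℚ)} (hH : shellsOK H = true) (k : ℝ) : rbBandK H k k = rbDiag H (cos k) := by
  rw [rbBandK_eq_UV hH]; rfl

/-- `ε(π, k) = rbFace H (cos k)`. [folklore] -/
theorem rbBandK_face {H : List (ℕ × ℕ × ℚ)} (hH : shellsOK H = true) (k : ℝ) : rbBandK H π k = rbFace H (cos k) := by
  rw [rbBandK_eq_UV hH, cos_pi]; rfl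

/-- [folklore] -/
theorem continuous_rbDiag (H : List (ℕ × ℕ × ℚ)) : Continuous (rbDiag H) :=
  (continuous_rbBandUV₂ H).comp (continuous_id.prodMk continuous_id)

/-- [folklore] -/
theorem continuous_rbFace (H : List (ℕ × ℕ × ℚ)) : Continuous (rbFace H) :=
  (continuous_rbBandUV₂ H).comp (continuous_const.prodMk continuous_id)

/-- `d/du ε(u, u) = ∂_u ε(u, u) + ∂_u ε_{Hᵀ}(u, u)`. [folklore] -/
theorem hasDerivAt_rbDiag (H : List (ℕ × ℕ × ℚ)) (u : ℝ) :
    HasDerivAt (rbDiag H) (rbBandU H u u + rbBandU (rbT H) u u) u := by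
  unfold rbDiag
  induction H with
  | nil => simp only [rbBandUV, rbBandU, rbT, List.map_nil, List.sum_nil, add_zero]; exact hasDerivAt_const u (0 : ℝ)
  | cons s H ih =>
    simp only [rbBandUV, rbBandU, rbT, List.map_cons, List.sum_cons, List.map_map] at ih ⊢
    have h := ((((hasDerivAt_axisFacUV s.1 u).mul (hasDerivAt_axisFacUV s.2.1 u))).const_mul (s.2.2 : ℝ)).add ih
    refine h.congr_deriv ?_
    have e : (List.map ((fun s : ℕ × ℕ × ℚ => (s.2.2 : ℝ) * (dAxisFacUV s.1 u * axisFacUV s.2.1 u)) ∘ fun s => (s.2.1, s.1, s.2.2)) H).sum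
        = (List.map (fun s : ℕ × ℕ × ℚ => (s.2.2 : ℝ) * (dAxisFacUV s.2.1 u * axisFacUV s.1 u)) H).sum := by rfl
    rw [e]; ring

/-- One-variable kd certificate of `∂_u ε(u,u) + ∂_u ε_{Hᵀ}(u,u) ≤ 0` on `[−1, 1]` (the band increases along the diagonal). [cite: Moore1966, Theorem 3.1, §4.4] -/
def rbDiagMonoCheck (H : List (ℕ × ℕ × ℚ)) (t : KdCert ℕ) : Bool :=
  t.check (exprLeOn (.add (rbBandUGE H (.var 0) (.var 0)) (rbBandUGE (rbT H) (.var 0) (.var 0))) 0) [(-1, 1)]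

/-- **The diagonal profile is antitone** from a passing certificate. [cite: Moore1966, Theorem 3.1, §4.4] -/
theorem rbDiagAnti_of_kdCheck {H : List (ℕ × ℕ × ℚ)} {t : KdCert ℕ} (h : rbDiagMonoCheck H t = true) :
    AntitoneOn (rbDiag H) (Icc (-1 : ℝ) 1) := by
  have hd : ∀ u ∈ Icc (-1 : ℝ) 1, rbBandU H u u + rbBandU (rbT H) u u ≤ 0 := by
    intro u hu
    have hu' : u ∈ Icc (((-1 : ℚ) : ℚ) : ℝ) ((1 : ℚ) : ℝ) := by simpa using hu
    have := eval_le_of_kdCheck h _ (box_mem₁ hu')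
    simpa [eval_rbBandUGE] using this
  refine antitoneOn_of_deriv_nonpos (convex_Icc _ _) (continuous_rbDiag H).continuousOn ?_ ?_
  · exact fun u _ => (hasDerivAt_rbDiag H u).differentiableAt.differentiableWithinAt
  · intro u hu
    rw [interior_Icc] at hu
    rw [(hasDerivAt_rbDiag H u).deriv]
    exact hd u (Ioo_subset_Icc_self hu)

/-! ## §2 Brackets, existence and velocity windows -/

/-- DIAGONAL BRACKET CHECK: `−1 ≤ ua < ub ≤ 1`, `ε(ub, ub) < e₁`, `e₂ < ε(ua, ua)`. [folklore] -/
def rbNodeBracketCheck (H : List (ℕ × ℕ × ℚ)) (e₁ e₂ ua ub : ℚ) : Bool :=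
  decide (-1 ≤ ua) && decide (ua < ub) && decide (ub ≤ 1) && decide (rbBandQ H ub ub < e₁) && decide (e₂ < rbBandQ H ua ua)

/-- X-FACE BRACKET CHECK: `−1 ≤ va < vb ≤ 1`, `ε(−1, vb) < e₁`, `e₂ < ε(−1, va)`. [folklore] -/
def rbFaceBracketCheck (H : List (ℕ × ℕ × ℚ)) (e₁ e₂ va vb : ℚ) : Bool :=
  decide (-1 ≤ va) && decide (va < vb) && decide (vb ≤ 1) && decide (rbBandQ H (-1) vb < e₁) && decide (e₂ < rbBandQ H (-1) va)

/-- Every diagonal Fermi point lies in the bracket. [folklore] -/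
theorem rbNode_cos_mem_Ioo {H : List (ℕ × ℕ × ℚ)} (hD : AntitoneOn (rbDiag H) (Icc (-1 : ℝ) 1)) {e₁ e₂ ua ub : ℚ}
    (h : rbNodeBracketCheck H e₁ e₂ ua ub = true) {ε : ℝ} (hε : ε ∈ Icc (e₁ : ℝ) e₂)
    {u : ℝ} (hu : u ∈ Icc (-1 : ℝ) 1) (hF : rbDiag H u = ε) : u ∈ Ioo (ua : ℝ) ub := by
  simp only [rbNodeBracketCheck, Bool.and_eq_true, decide_eq_true_eq] at h
  obtain ⟨⟨⟨⟨ha, hab⟩, hb⟩, hhi⟩, hlo⟩ := h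
  have ha' : (-1 : ℝ) ≤ ua := by exact_mod_cast ha
  have hb' : (ub : ℝ) ≤ 1 := by exact_mod_cast hb
  have hab' : (ua : ℝ) < ub := by exact_mod_cast hab
  have hhi' := (Rat.cast_lt (K := ℝ)).2 hhi
  have hlo' := (Rat.cast_lt (K := ℝ)).2 hlo
  rw [cast_rbBandQ] at hhi' hlo'
  have hua : (ua : ℝ) ∈ Icc (-1 : ℝ) 1 := ⟨ha', hab'.le.trans hb'⟩
  have hub : (ub : ℝ) ∈ Icc (-1 : ℝ) 1 := ⟨ha'.trans hab'.le, hb'⟩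
  constructor
  · by_contra hle
    have := hD hu hua (not_lt.1 hle)
    unfold rbDiag at this hF; linarith [hε.2]
  · by_contra hle
    have := hD hub hu (not_lt.1 hle)
    unfold rbDiag at this hF; linarith [hε.1]

/-- Every X-face Fermi point lies in the bracket. [folklore] -/
theorem rbFace_cos_mem_Ioo {H : List (ℕ × ℕ × ℚ)} (hFa : AntitoneOn (rbFace H) (Icc (-1 : ℝ) 1)) {e₁ e₂ va vb : ℚ}
    (h : rbFaceBracketCheck H e₁ e₂ va vb = true) {ε : ℝ} (hε : ε ∈ Icc (e₁ : ℝ) e₂)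
    {v : ℝ} (hv : v ∈ Icc (-1 : ℝ) 1) (hF : rbFace H v = ε) : v ∈ Ioo (va : ℝ) vb := by
  simp only [rbFaceBracketCheck, Bool.and_eq_true, decide_eq_true_eq] at h
  obtain ⟨⟨⟨⟨ha, hab⟩, hb⟩, hhi⟩, hlo⟩ := h
  have ha' : (-1 : ℝ) ≤ va := by exact_mod_cast ha
  have hb' : (vb : ℝ) ≤ 1 := by exact_mod_cast hb
  have hab' : (va : ℝ) < vb := by exact_mod_cast hab
  have hhi' := (Rat.cast_lt (K := ℝ)).2 hhi
  have hlo' := (Rat.cast_lt (K := ℝ)).2 hlo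
  rw [cast_rbBandQ] at hhi' hlo'
  push_cast at hhi' hlo'
  have hva : (va : ℝ) ∈ Icc (-1 : ℝ) 1 := ⟨ha', hab'.le.trans hb'⟩
  have hvb : (vb : ℝ) ∈ Icc (-1 : ℝ) 1 := ⟨ha'.trans hab'.le, hb'⟩
  constructor
  · by_contra hle
    have := hFa hv hva (not_lt.1 hle)
    unfold rbFace at this hF; linarith [hε.2]
  · by_contra hle
    have := hFa hvb hv (not_lt.1 hle)
    unfold rbFace at this hF; linarith [hε.1]

/-- A diagonal and an X-face Fermi point EXIST (IVT). [folklore] -/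
theorem rbNodeFace_exist {H : List (ℕ × ℕ × ℚ)} (hH : shellsOK H = true) {e₁ e₂ ua ub va vb : ℚ}
    (hnb : rbNodeBracketCheck H e₁ e₂ ua ub = true) (hfb : rbFaceBracketCheck H e₁ e₂ va vb = true)
    {ε : ℝ} (hε : ε ∈ Icc (e₁ : ℝ) e₂) :
    (∃ k ∈ Icc (0 : ℝ) π, rbBandK H k k = ε) ∧ (∃ k ∈ Icc (0 : ℝ) π, rbBandK H π k = ε) := by
  have hn := hnb; have hf := hfb
  simp only [rbNodeBracketCheck, rbFaceBracketCheck, Bool.and_eq_true, decide_eq_true_eq] at hn hf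
  obtain ⟨⟨⟨⟨hna, hnab⟩, hnb1⟩, hnhi⟩, hnlo⟩ := hn
  obtain ⟨⟨⟨⟨hfa, hfab⟩, hfb1⟩, hfhi⟩, hflo⟩ := hf
  have hnhi' := (Rat.cast_lt (K := ℝ)).2 hnhi
  have hnlo' := (Rat.cast_lt (K := ℝ)).2 hnlo
  have hfhi' := (Rat.cast_lt (K := ℝ)).2 hfhi
  have hflo' := (Rat.cast_lt (K := ℝ)).2 hflo
  rw [cast_rbBandQ] at hnhi' hnlo' hfhi' hflo'
  push_cast at hfhi' hflo'
  constructor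
  · have hab' : (ua : ℝ) ≤ ub := by exact_mod_cast hnab.le
    obtain ⟨u, hu, hfu⟩ := intermediate_value_Icc' hab' (continuous_rbDiag H).continuousOn
      (⟨by unfold rbDiag; linarith [hε.1], by unfold rbDiag; linarith [hε.2]⟩ : ε ∈ Icc (rbDiag H ub) (rbDiag H ua))
    have hu1 : -1 ≤ u := le_trans (by exact_mod_cast hna) hu.1
    have hu2 : u ≤ 1 := hu.2.trans (by exact_mod_cast hnb1)
    refine ⟨arccos u, ⟨arccos_nonneg u, arccos_le_pi u⟩, ?_⟩
    rw [rbBandK_diag hH, cos_arccos hu1 hu2]; exact hfu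
  · have hab' : (va : ℝ) ≤ vb := by exact_mod_cast hfab.le
    obtain ⟨v, hv, hfv⟩ := intermediate_value_Icc' hab' (continuous_rbFace H).continuousOn
      (⟨by unfold rbFace; linarith [hε.1], by unfold rbFace; linarith [hε.2]⟩ : ε ∈ Icc (rbFace H vb) (rbFace H va))
    have hv1 : -1 ≤ v := le_trans (by exact_mod_cast hfa) hv.1
    have hv2 : v ≤ 1 := hv.2.trans (by exact_mod_cast hfb1)
    refine ⟨arccos v, ⟨arccos_nonneg v, arccos_le_pi v⟩, ?_⟩
    rw [rbBandK_face hH, cos_arccos hv1 hv2]; exact hfv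

/-- `|∇ε|²` on the diagonal as a one-variable `ArithExpr` (`x 0 = u`): `(1 − u²)((∂_u ε(u,u))² + (∂_u ε_{Hᵀ}(u,u))²)`. [folklore] -/
def rbNodeGradSqE (H : List (ℕ × ℕ × ℚ)) : ArithExpr :=
  .mul (.sub (.const 1) (.mul (.var 0) (.var 0)))
    (.add (.mul (rbBandUGE H (.var 0) (.var 0)) (rbBandUGE H (.var 0) (.var 0)))
      (.mul (rbBandUGE (rbT H) (.var 0) (.var 0)) (rbBandUGE (rbT H) (.var 0) (.var 0))))

/-- `|∇ε|²` on the X face as a one-variable `ArithExpr` (`x 0 = v`): `(1 − v²)(∂_u ε_{Hᵀ}(v, −1))²`. [folklore] -/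
def rbFaceGradSqE (H : List (ℕ × ℕ × ℚ)) : ArithExpr :=
  .mul (.sub (.const 1) (.mul (.var 0) (.var 0)))
    (.mul (rbBandUGE (rbT H) (.var 0) (.const (-1))) (rbBandUGE (rbT H) (.var 0) (.const (-1))))

/-- [folklore] -/
theorem rbGradSq_diag {H : List (ℕ × ℕ × ℚ)} (k : ℝ) :
    rbGradSq H k k = (rbNodeGradSqE H).eval (fun i => if i = 0 then cos k else 0) := by
  simp [rbNodeGradSqE, eval_rbBandUGE, rbGradSq]
  have hs : sin k ^ 2 = 1 - cos k ^ 2 := by rw [sin_sq]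
  linear_combination (rbBandU H (cos k) (cos k) ^ 2 + rbBandU (rbT H) (cos k) (cos k) ^ 2) * hs

/-- [folklore] -/
theorem rbGradSq_face {H : List (ℕ × ℕ × ℚ)} (k : ℝ) :
    rbGradSq H π k = (rbFaceGradSqE H).eval (fun i => if i = 0 then cos k else 0) := by
  simp [rbFaceGradSqE, eval_rbBandUGE, rbGradSq, sin_pi, cos_pi]
  have hs : sin k ^ 2 = 1 - cos k ^ 2 := by rw [sin_sq]
  linear_combination (rbBandU (rbT H) (cos k) (-1) ^ 2) * hs

/-- **DIAGONAL FERMI POINT, pointwise**: given `ε ∈ [e₁, e₂]`, the bracket, a velocity window on it and the diagonal monotonicity, every diagonal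
Fermi momentum has `cos k ∈ (ua, ub)` and `|∇ε|²(k, k) ∈ [w_lo, w_hi]`. [folklore] -/
theorem rbNode_of_lineChecks {H : List (ℕ × ℕ × ℚ)} (hH : shellsOK H = true) {td : KdCert ℕ} (hd : rbDiagMonoCheck H td = true)
    {e₁ e₂ ua ub wlo whi : ℚ} {t₁ t₂ : KdCert ℕ}
    (hnb : rbNodeBracketCheck H e₁ e₂ ua ub = true) (hw : windowCheck₁ (rbNodeGradSqE H) ua ub wlo whi t₁ t₂ = true)
    {ε : ℝ} (hε : ε ∈ Icc (e₁ : ℝ) e₂) {k : ℝ} (hF : rbBandK H k k = ε) :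
    cos k ∈ Ioo (ua : ℝ) ub ∧ rbGradSq H k k ∈ Icc (wlo : ℝ) whi := by
  rw [rbBandK_diag hH] at hF
  have hu := rbNode_cos_mem_Ioo (rbDiagAnti_of_kdCheck hd) hnb hε ⟨neg_one_le_cos k, cos_le_one k⟩ hF
  refine ⟨hu, ?_⟩
  have hwin := window_of_check₁ hw (Ioo_subset_Icc_self hu)
  rw [rbGradSq_diag]; exact hwin

/-- **X-FACE FERMI POINT, pointwise.** [folklore] -/
theorem rbFace_of_lineChecks {H : List (ℕ × ℕ × ℚ)} (hH : shellsOK H = true) {tf : KdCert ℕ} (hf : rbFaceMonoCheck H tf = true)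
    {e₁ e₂ va vb wlo whi : ℚ} {t₁ t₂ : KdCert ℕ}
    (hfb : rbFaceBracketCheck H e₁ e₂ va vb = true) (hw : windowCheck₁ (rbFaceGradSqE H) va vb wlo whi t₁ t₂ = true)
    {ε : ℝ} (hε : ε ∈ Icc (e₁ : ℝ) e₂) {k : ℝ} (hF : rbBandK H π k = ε) :
    cos k ∈ Ioo (va : ℝ) vb ∧ rbGradSq H π k ∈ Icc (wlo : ℝ) whi := by
  rw [rbBandK_face hH] at hF
  have hv := rbFace_cos_mem_Ioo (rbFaceAnti_of_kdCheck hf) hfb hε ⟨neg_one_le_cos k, cos_le_one k⟩ hF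
  refine ⟨hv, ?_⟩
  have hwin := window_of_check₁ hw (Ioo_subset_Icc_self hv)
  rw [rbGradSq_face]; exact hwin

/-! ## §3 The `t–t′` form defect of the diagonal / X-face pair -/

/-- [folklore] -/
theorem eval_rbNodeGradSqE_pt₂ (H : List (ℕ × ℕ × ℚ)) (u v : ℝ) :
    (rbNodeGradSqE H).eval (pt₂ u v) = (rbNodeGradSqE H).eval (fun i => if i = 0 then u else 0) := by
  simp [rbNodeGradSqE, eval_rbBandUGE, pt₂]

/-- The X-face velocity in the variable `x 1 = v`. [folklore] -/
def rbFaceGradSqE₁ (H : List (ℕ × ℕ × ℚ)) : ArithExpr :=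
  .mul (.sub (.const 1) (.mul (.var 1) (.var 1)))
    (.mul (rbBandUGE (rbT H) (.var 1) (.const (-1))) (rbBandUGE (rbT H) (.var 1) (.const (-1))))

/-- [folklore] -/
theorem eval_rbFaceGradSqE₁_pt₂ (H : List (ℕ × ℕ × ℚ)) (u v : ℝ) :
    (rbFaceGradSqE₁ H).eval (pt₂ u v) = (rbFaceGradSqE H).eval (fun i => if i = 0 then v else 0) := by
  simp [rbFaceGradSqE₁, rbFaceGradSqE, eval_rbBandUGE, pt₂]

/-- Claim term: `tn_lo²·nodeFormN − rhoD²·V_n²` (rectangular band). [folklore] -/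
def rbFcNodeLo (H : List (ℕ × ℕ × ℚ)) (tnlo : ℚ) : ArithExpr :=
  .sub (.mul (.const (tnlo ^ 2)) nodeFormNE) (.mul (.mul rhoDE rhoDE) (rbNodeGradSqE H))
/-- Claim term: `rhoD²·V_n² − tn_hi²·nodeFormN`. [folklore] -/
def rbFcNodeHi (H : List (ℕ × ℕ × ℚ)) (tnhi : ℚ) : ArithExpr :=
  .sub (.mul (.mul rhoDE rhoDE) (rbNodeGradSqE H)) (.mul (.const (tnhi ^ 2)) nodeFormNE)
/-- Claim term: `ta_lo²·faceFormN − rhoD²·V_a²`. [folklore] -/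
def rbFcFaceLo (H : List (ℕ × ℕ × ℚ)) (talo : ℚ) : ArithExpr :=
  .sub (.mul (.const (talo ^ 2)) faceFormNE) (.mul (.mul rhoDE rhoDE) (rbFaceGradSqE₁ H))
/-- Claim term: `rhoD²·V_a² − ta_hi²·faceFormN`. [folklore] -/
def rbFcFaceHi (H : List (ℕ × ℕ × ℚ)) (tahi : ℚ) : ArithExpr :=
  .sub (.mul (.mul rhoDE rhoDE) (rbFaceGradSqE₁ H)) (.mul (.const (tahi ^ 2)) faceFormNE)
/-- Claim term: `(1+δ)²·nodeFormN·V_a² − faceFormN·V_n²`. [folklore] -/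
def rbFcDefect (H : List (ℕ × ℕ × ℚ)) (δ : ℚ) : ArithExpr :=
  .sub (.mul (.mul (.const ((1 + δ) ^ 2)) nodeFormNE) (rbFaceGradSqE₁ H)) (.mul faceFormNE (rbNodeGradSqE H))

/-- **THE FORM THEOREM (rectangular band, diagonal / X-face pair), pointwise**: the `t–t′` contour through the two Fermi points, the matched
scales `t_node`, `t_an` and the form defect `δ`, from the eight kd claims on the bracket box, given `cos kn ∈ [ua, ub]`, `cos ka ∈ [va, vb]`. [folklore] -/
theorem rbForm_of_windows {H : List (ℕ × ℕ × ℚ)} {ua ub va vb tnlo tnhi talo tahi δ η : ℚ}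
    {t0 t1 t2 t3 t4 t5 t6 t7 : KdCert ℕ}
    (hsg : formSignCheck tnlo tnhi talo tahi δ η = true)
    (h0 : t0.check (exprLeOn (fcRhoD η) 0) [(ua, ub), (va, vb)] = true)
    (h1 : t1.check (exprLeOn (fcNodePos η) 0) [(ua, ub), (va, vb)] = true)
    (h2 : t2.check (exprLeOn (fcFacePos η) 0) [(ua, ub), (va, vb)] = true)
    (h3 : t3.check (exprLeOn (rbFcNodeLo H tnlo) 0) [(ua, ub), (va, vb)] = true)
    (h4 : t4.check (exprLeOn (rbFcNodeHi H tnhi) 0) [(ua, ub), (va, vb)] = true)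
    (h5 : t5.check (exprLeOn (rbFcFaceLo H talo) 0) [(ua, ub), (va, vb)] = true)
    (h6 : t6.check (exprLeOn (rbFcFaceHi H tahi) 0) [(ua, ub), (va, vb)] = true)
    (h7 : t7.check (exprLeOn (rbFcDefect H δ) 0) [(ua, ub), (va, vb)] = true)
    {kn ka : ℝ} (hu : cos kn ∈ Icc (ua : ℝ) ub) (hv : cos ka ∈ Icc (va : ℝ) vb) :
    oneBand 0 1 (ttpRho (cos kn) (cos ka)) 0 kn kn = oneBand 0 1 (ttpRho (cos kn) (cos ka)) 0 π ka ∧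
    (∀ t : ℝ, 0 ≤ t → t ^ 2 * ttpGradSqUV (ttpRho (cos kn) (cos ka)) (cos kn) (cos kn) = rbGradSq H kn kn →
      t ∈ Icc (tnlo : ℝ) tnhi) ∧
    (∀ t : ℝ, 0 ≤ t → t ^ 2 * ttpGradSqUV (ttpRho (cos kn) (cos ka)) (-1) (cos ka) = rbGradSq H π ka →
      t ∈ Icc (talo : ℝ) tahi) ∧
    (1 + (δ : ℝ)) ^ 2 * (ttpGradSqUV (ttpRho (cos kn) (cos ka)) (cos kn) (cos kn) * rbGradSq H π ka) ≤
      ttpGradSqUV (ttpRho (cos kn) (cos ka)) (-1) (cos ka) * rbGradSq H kn kn := by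
  rw [rbGradSq_diag, rbGradSq_face]
  set u := cos kn with hu_def
  set v := cos ka with hv_def
  set Vn := (rbNodeGradSqE H).eval (fun i => if i = 0 then u else 0) with hVn
  set Va := (rbFaceGradSqE H).eval (fun i => if i = 0 then v else 0) with hVa
  simp only [formSignCheck, Bool.and_eq_true, decide_eq_true_eq] at hsg
  obtain ⟨⟨⟨⟨⟨hη, htnlo⟩, htnhi⟩, htalo⟩, htahi⟩, hδ⟩ := hsg
  have c0 := eval_pt₂_le_of_kdCheck h0 hu hv
  have c1 := eval_pt₂_le_of_kdCheck h1 hu hv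
  have c2 := eval_pt₂_le_of_kdCheck h2 hu hv
  have c3 := eval_pt₂_le_of_kdCheck h3 hu hv
  have c4 := eval_pt₂_le_of_kdCheck h4 hu hv
  have c5 := eval_pt₂_le_of_kdCheck h5 hu hv
  have c6 := eval_pt₂_le_of_kdCheck h6 hu hv
  have c7 := eval_pt₂_le_of_kdCheck h7 hu hv
  simp only [fcRhoD, fcNodePos, fcFacePos, rbFcNodeLo, rbFcNodeHi, rbFcFaceLo, rbFcFaceHi, rbFcDefect,
    ArithExpr.eval_sub, ArithExpr.eval_mul, ArithExpr.eval_const, eval_rhoDE, eval_nodeFormNE,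
    eval_faceFormNE, eval_rbNodeGradSqE_pt₂, eval_rbFaceGradSqE₁_pt₂, pt₂_zero, pt₂_one, Rat.cast_pow, Rat.cast_add,
    Rat.cast_one, Rat.cast_zero] at c0 c1 c2 c3 c4 c5 c6 c7
  rw [← hVn] at c3 c4 c7
  rw [← hVa] at c5 c6 c7
  have hη' : (0 : ℝ) < η := by exact_mod_cast hη
  have hD : 0 < rhoD u v := by linarith
  have hDne : rhoD u v ≠ 0 := hD.ne'
  have hNf : 0 < nodeFormN u v := by linarith
  have hFf : 0 < faceFormN u v := by linarith
  have hGn : ttpGradSqUV (ttpRho u v) u u = nodeFormN u v / rhoD u v ^ 2 := by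
    rw [← nodeFormN_eq hDne]; field_simp
  have hGf : ttpGradSqUV (ttpRho u v) (-1) v = faceFormN u v / rhoD u v ^ 2 := by
    rw [← faceFormN_eq hDne]; field_simp
  have hD2 : 0 < rhoD u v ^ 2 := by positivity
  refine ⟨?_, ?_, ?_, ?_⟩
  · rw [← ttpUV_eq_oneBand, ← ttpUV_eq_oneBand, cos_pi]
    exact ttpRho_contour hDne
  · intro t ht hmatch
    rw [hGn] at hmatch
    have key : t ^ 2 * nodeFormN u v = rhoD u v ^ 2 * Vn := by
      rw [← hmatch]; field_simp
    have htnlo' : (0 : ℝ) ≤ tnlo := by exact_mod_cast htnlo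
    have htnhi' : (0 : ℝ) ≤ tnhi := by exact_mod_cast htnhi
    constructor
    · refine le_of_sq_le_sq' ?_ htnlo' ht
      exact le_of_mul_le_mul_right (by linarith) hNf
    · refine le_of_sq_le_sq' ?_ ht htnhi'
      exact le_of_mul_le_mul_right (by linarith) hNf
  · intro t ht hmatch
    rw [hGf] at hmatch
    have key : t ^ 2 * faceFormN u v = rhoD u v ^ 2 * Va := by
      rw [← hmatch]; field_simp
    have htalo' : (0 : ℝ) ≤ talo := by exact_mod_cast htalo
    have htahi' : (0 : ℝ) ≤ tahi := by exact_mod_cast htahi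
    constructor
    · refine le_of_sq_le_sq' ?_ htalo' ht
      exact le_of_mul_le_mul_right (by linarith) hFf
    · refine le_of_sq_le_sq' ?_ ht htahi'
      exact le_of_mul_le_mul_right (by linarith) hFf
  · rw [hGn, hGf]
    rw [show (1 + (δ : ℝ)) ^ 2 * (nodeFormN u v / rhoD u v ^ 2 * Va) =
        ((1 + (δ : ℝ)) ^ 2 * nodeFormN u v * Va) / rhoD u v ^ 2 by field_simp]
    rw [show faceFormN u v / rhoD u v ^ 2 * Vn = (faceFormN u v * Vn) / rhoD u v ^ 2 by field_simp]
    exact div_le_div_of_nonneg_right (by linarith) hD2.le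

end Summit.Ventures.CertifiedManyBodySolver.Downfold.Emery
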